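import Summits.QuantumFields.BalabanUV.Beta.EriceRemainderEnclosureHistoryAutonomyComparisonAgeCompositionFadingEnvelope

/-!
# EriceRemainderEnclosureHistoryAutonomyComparisonAgeCompositionFadingEnvelopeFreedom — (E114b) route (N), first order: ASYMPTOTIC FREEDOM EXTINGUISHES THE
# OLD TAIL.  (E114a) bounds the old tail of the total window load under an envelope `L_k ≤ Λ_k` (`k ≥ kₑ`) through the BOX, `h ≤ γ`.  Along a box SOLUTION
# the flow itself does better, uniformly in the pin: the levels grow at least linearly, `1∕h(n)² = 1∕gIR² + Σ_{l<n} B(h(l+1+·)) ≥ n·b` (node U2's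
# `invSq_eq_of_memFlow`, `mul_lower_le_drive` — the floor `b > 0` of the memory), so the coupling read by the age `k` at ANY pin is `h(m+k)² ≤ 1∕(k·b)` and
# `k·h(m+k)³ ≤ 1∕(b√b·√k)` (**`mul_cube_le_of_floor`**).  Hence
#     `Σ_{kₑ ≤ k < K} k·L_kh(m+k)³∕2 ≤ (2b√b·√kₑ)⁻¹·Σ_{kₑ ≤ k < K} Λ_k ≤ Cm·θ^{kₑ}∕(2(1−θ)·b√b·√kₑ)`
# for the geometric envelope `Λ_k = Cm·θ^k` (**`old_tail_load_le_of_envelope_floor`**, **`old_tail_load_le_geometric_floor`**) — EVERY range `K`, every pin,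
# no `γ` — and, with the young cluster `[1,kₑ)` bounded by (E112b) exactly as in (E114a), THE END AT EVERY RANGE under the displayed inequality
#     `(√2∕2)(1 + (log kₑ − log 2)∕8) + Cm·θ^{kₑ}∕(2(1−θ)·b√b·√kₑ) ≤ 1`
# (**`total_load_le_one_of_geometric_envelope_floor`**, **`flow_nonneg_of_geometric_envelope_floor`**; instance **`flow_nonneg_of_envelope_floor_half`**: `θ ≤ ½`,
# `kₑ = 32`, `Cm ≤ 10⁹·b√b`).  READING (README `HOME/b2b-balaban-beta-d4-p2/g95/README.md` §1, §3): the two tails are the two scale-invariant smallness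
# parameters of a fading memory — `Cm·γ³` (the box) and `Cm·b^{−3∕2}` (the floor) —; either one small enough relative to `θ^{kₑ}` closes the mass route at every
# range, and the exponent `kₑ` is free up to the young-range frontier of the census (`[1,53]`).

Cell `pub-balaban`, β-function sub-cell, BINDER row D4 «RemainderConst leaves for Bałaban's split» (`HOME/BINDER-OWNERS.md`; owner lineage `b2b-balaban-beta-an4`;
this file by co-owner #2 lineage `b2b-balaban-beta-d4-p2`, generation 95), β-FLOW TEAM duty (1), FREEZE (0) honoured (def-free; imports (E114a); uses (E114a)
`young_cluster_le_log`, `young_cluster_load_eq`, `total_load_le_of_young_and_tail`, (E112b) `sqrt_two_div_two_le`, (E89b) `flow_nonneg_of_window_loads_le_one`,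
node U2's `invSq_eq_of_memFlow`, `mul_lower_le_drive`, Mathlib's `geom_sum_Ico_le_of_lt_one` BY NAME; the display of `KL`, `KA`, `RA` is (E86i)'s VERBATIM;
nothing restated).

HONEST FRAMING (page 1, verbatim and binding).  *"Discharging BetaPertH makes Bałaban's UV stability UNCONDITIONAL — a real constructive-QFT result; it is
NOT the continuum limit and NOT the Clay problem."*  THIS FILE DISCHARGES NOTHING OF THE KIND.  Elementary real analysis about ABSTRACT functionals on a box
]0,γ]^ℕ with displayed floors, profiles, envelopes and signs, and the FIRST-ORDER renewal objects of route (N) built from them — hypotheses of a census, not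
facts; the form, signs, ages, moments and memory profile of Bałaban's (1.22) limit functional are NOT PRINTED ([I] p. 298; GAPS G-t4-U2-1∕-2) and NOT asserted.
Row D4 class UNCHANGED (critical-path width 0; instance 0∕1; D4 DISCHARGE NO DATE).  HONEST DEPENDENCY: continuum YM on T⁴ ⇐ BetaPertH ∧ nine spine estimates
(0/9 proved); BetaPertH ⇐ (D1) ∧ (D4) ∧ CAP+tail; G-an2-4 gates asym, D1 and NE2/3/4.

NOT CLAIMED: the END without an envelope at every range; any improvement of the young-range frontier; anything printed — NOT B12 Thm 2, NOT BetaPertH.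

WHAT IS PROVED ([folklore]; 0 `def`, 0 sorry).  §1 `invSq_ge_mul_floor`, `sq_le_of_floor`, **`mul_cube_le_of_floor`**.  §2 **`old_tail_load_le_of_envelope_floor`**,
**`old_tail_load_le_geometric_floor`**.  §3 **`total_load_le_one_of_geometric_envelope_floor`**, **`flow_nonneg_of_geometric_envelope_floor`**.
§4 **`flow_nonneg_of_envelope_floor_half`**.
-/
noncomputable section
open Finset

namespace Summit.QuantumFields.BalabanUV.Beta.EriceRemainderEnclosureHistoryAutonomyComparisonAgeCompositionFadingEnvelopeFreedom

open Literature.MathematicalPhysics.QuantumFieldTheory.Balaban1983to89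
open Literature.MathematicalPhysics.QuantumFieldTheory.Balaban1983to89.T4BetaStationary
open Literature.MathematicalPhysics.QuantumFieldTheory.Balaban1983to89.T4BetaFlowWellPosed
open Summit.QuantumFields.BalabanUV.Beta.EriceRemainderEnclosureHistoryAutonomyComparisonAgeCompositionThreeAgesMassCap (flow_nonneg_of_window_loads_le_one)
open Summit.QuantumFields.BalabanUV.Beta.EriceRemainderEnclosureHistoryAutonomyComparisonAgeCompositionAgeRatioWindowClusters (sqrt_two_div_two_le)
open Summit.QuantumFields.BalabanUV.Beta.EriceRemainderEnclosureHistoryAutonomyComparisonAgeCompositionFadingEnvelope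
  (young_cluster_le_log young_cluster_load_eq total_load_le_of_young_and_tail)

variable {B : (ℕ → ℝ) → ℝ} {γ b gIR : ℝ} {L : ℕ → ℝ} {K : ℕ} {h g : ℕ → ℝ}

/-! ## §1 Asymptotic freedom: the coupling read by the age `k` -/

/-- **THE LEVELS GROW AT LEAST LINEARLY**: along a box solution of a memory with floor `b`, `n·b ≤ 1∕h(n)²` at every scale. [folklore] -/
theorem invSq_ge_mul_floor (hlo : ∀ u, SeqBox γ u → b ≤ B u) (hh : SeqBox γ h) (hf : MemFlow B gIR h) (n : ℕ) :
    (n : ℝ) * b ≤ 1 / h n ^ 2 := by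
  rw [invSq_eq_of_memFlow hf n]
  have h1 := mul_lower_le_drive hlo hh n
  have h2 : 0 ≤ 1 / gIR ^ 2 := by positivity
  linarith

/-- The coupling read by the age `k ≥ 1` at any pin: `h(m+k)² ≤ 1∕(k·b)` (`b > 0`). [folklore] -/
theorem sq_le_of_floor (hb : 0 < b) (hlo : ∀ u, SeqBox γ u → b ≤ B u) (hh : SeqBox γ h) (hf : MemFlow B gIR h) (m : ℕ) {k : ℕ} (hk : 1 ≤ k) :
    h (m + k) ^ 2 ≤ 1 / ((k : ℝ) * b) := by
  have h0 := (hh (m + k)).1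
  have hk0 : (0 : ℝ) < k := by exact_mod_cast hk
  have hkb : 0 < (k : ℝ) * b := mul_pos hk0 hb
  have h1 := invSq_ge_mul_floor hlo hh hf (m + k)
  have h2 : (k : ℝ) * b ≤ 1 / h (m + k) ^ 2 := by
    have : (k : ℝ) * b ≤ ((m + k : ℕ) : ℝ) * b := by
      push_cast; nlinarith [Nat.cast_nonneg (α := ℝ) m]
    exact this.trans h1
  rw [le_one_div (pow_pos h0 2) hkb]
  exact h2

/-- **`k·h(m+k)³ ≤ 1∕(b√b·√k)`** for every age `k ≥ 1` at every pin (`b > 0`). [folklore] -/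
theorem mul_cube_le_of_floor (hb : 0 < b) (hlo : ∀ u, SeqBox γ u → b ≤ B u) (hh : SeqBox γ h) (hf : MemFlow B gIR h) (m : ℕ) {k : ℕ}
    (hk : 1 ≤ k) : (k : ℝ) * h (m + k) ^ 3 ≤ 1 / (b * Real.sqrt b * Real.sqrt k) := by
  have h0 := (hh (m + k)).1
  have hk0 : (0 : ℝ) < k := by exact_mod_cast hk
  have hsq := sq_le_of_floor hb hlo hh hf m hk
  have hsb := Real.sqrt_pos.2 hb
  have hsk := Real.sqrt_pos.2 hk0
  -- `h ≤ 1∕√(k b)`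
  have hroot : h (m + k) ≤ 1 / (Real.sqrt k * Real.sqrt b) := by
    have e1 : Real.sqrt (h (m + k) ^ 2) = h (m + k) := Real.sqrt_sq h0.le
    have e2 : Real.sqrt (1 / ((k : ℝ) * b)) = 1 / (Real.sqrt k * Real.sqrt b) := by
      rw [Real.sqrt_div' _ (by positivity), Real.sqrt_one, Real.sqrt_mul hk0.le]
    rw [← e1, ← e2]
    exact Real.sqrt_le_sqrt hsq
  -- `k·h³ = k·h²·h`
  have e3 : (k : ℝ) * h (m + k) ^ 3 = (k : ℝ) * h (m + k) ^ 2 * h (m + k) := by ring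
  rw [e3]
  have h3 : (k : ℝ) * h (m + k) ^ 2 ≤ 1 / b := by
    have := mul_le_mul_of_nonneg_left hsq hk0.le
    rw [show (k : ℝ) * (1 / ((k : ℝ) * b)) = 1 / b by field_simp] at this
    exact this
  have esb : Real.sqrt b * Real.sqrt b = b := Real.mul_self_sqrt hb.le
  calc (k : ℝ) * h (m + k) ^ 2 * h (m + k) ≤ 1 / b * (1 / (Real.sqrt k * Real.sqrt b)) :=
        mul_le_mul h3 hroot h0.le (by positivity)
    _ = 1 / (b * Real.sqrt b * Real.sqrt k) := by field_simp

/-! ## §2 The old tail through the floor -/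

/-- **THE OLD TAIL UNDER AN ENVELOPE, THROUGH THE FLOOR.**  `B` with floor `b > 0`, `h` a box solution, `L ≥ 0`, `L_k ≤ Λ_k` for `k ≥ kₑ ≥ 1`.  Then at every
pin and for EVERY range `K`: `Σ_{kₑ ≤ k < K} k·L_kh(m+k)³∕2 ≤ (2b√b·√kₑ)⁻¹·Σ_{kₑ ≤ k < K} Λ_k`. [folklore] -/
theorem old_tail_load_le_of_envelope_floor (hL : ∀ k, 0 ≤ L k) (hb : 0 < b) (hlo : ∀ u, SeqBox γ u → b ≤ B u) (hh : SeqBox γ h)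
    (hf : MemFlow B gIR h) {Λ : ℕ → ℝ} {kₑ : ℕ} (hkₑ : 1 ≤ kₑ) (henv : ∀ k, kₑ ≤ k → L k ≤ Λ k) (m : ℕ) :
    ∑ k ∈ Ico kₑ K, (k : ℝ) * (L k * h (m + k) ^ 3 / 2) ≤ 1 / (2 * b * Real.sqrt b * Real.sqrt kₑ) * ∑ k ∈ Ico kₑ K, Λ k := by
  have hsb := Real.sqrt_pos.2 hb
  have hse : 0 < Real.sqrt kₑ := Real.sqrt_pos.2 (by exact_mod_cast hkₑ)
  rw [mul_sum]
  refine sum_le_sum fun k hk => ?_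
  have hke : kₑ ≤ k := (mem_Ico.mp hk).1
  have hk1 : 1 ≤ k := hkₑ.trans hke
  have h0 := (hh (m + k)).1
  have hΛ : 0 ≤ Λ k := (hL k).trans (henv k hke)
  have hcube := mul_cube_le_of_floor hb hlo hh hf m hk1
  -- `1∕√k ≤ 1∕√kₑ`
  have hsk : Real.sqrt kₑ ≤ Real.sqrt k := Real.sqrt_le_sqrt (by exact_mod_cast hke)
  have hcube' : (k : ℝ) * h (m + k) ^ 3 ≤ 1 / (b * Real.sqrt b * Real.sqrt kₑ) :=
    hcube.trans (one_div_le_one_div_of_le (by positivity) (mul_le_mul_of_nonneg_left hsk (by positivity)))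
  calc (k : ℝ) * (L k * h (m + k) ^ 3 / 2) = L k / 2 * ((k : ℝ) * h (m + k) ^ 3) := by ring
    _ ≤ Λ k / 2 * (1 / (b * Real.sqrt b * Real.sqrt kₑ)) :=
        mul_le_mul (by linarith [henv k hke]) hcube' (by have := hL k; positivity) (by positivity)
    _ = 1 / (2 * b * Real.sqrt b * Real.sqrt kₑ) * Λ k := by field_simp

/-- **THE OLD TAIL UNDER A GEOMETRIC ENVELOPE, THROUGH THE FLOOR** (`L_k ≤ Cm·θ^k` for `k ≥ kₑ ≥ 1`, `0 ≤ θ < 1`, `Cm ≥ 0`): at every pin and for EVERY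
range `K`, `Σ_{kₑ ≤ k < K} k·L_kh(m+k)³∕2 ≤ Cm·θ^{kₑ}∕(2(1−θ)·b√b·√kₑ)`. [folklore] -/
theorem old_tail_load_le_geometric_floor (hL : ∀ k, 0 ≤ L k) (hb : 0 < b) (hlo : ∀ u, SeqBox γ u → b ≤ B u) (hh : SeqBox γ h)
    (hf : MemFlow B gIR h) {Cm θ : ℝ} {kₑ : ℕ} (hkₑ : 1 ≤ kₑ) (hCm : 0 ≤ Cm) (hθ0 : 0 ≤ θ) (hθ1 : θ < 1)
    (henv : ∀ k, kₑ ≤ k → L k ≤ Cm * θ ^ k) (m : ℕ) :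
    ∑ k ∈ Ico kₑ K, (k : ℝ) * (L k * h (m + k) ^ 3 / 2) ≤ Cm * θ ^ kₑ / (2 * (1 - θ) * b * Real.sqrt b * Real.sqrt kₑ) := by
  have hsb := Real.sqrt_pos.2 hb
  have hse : 0 < Real.sqrt kₑ := Real.sqrt_pos.2 (by exact_mod_cast hkₑ)
  have h1θ : 0 < 1 - θ := by linarith
  have h1 := old_tail_load_le_of_envelope_floor (K := K) hL hb hlo hh hf hkₑ henv m
  have h2 : ∑ k ∈ Ico kₑ K, Cm * θ ^ k ≤ Cm * (θ ^ kₑ / (1 - θ)) := by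
    rw [← mul_sum]; exact mul_le_mul_of_nonneg_left (geom_sum_Ico_le_of_lt_one hθ0 hθ1) hCm
  calc ∑ k ∈ Ico kₑ K, (k : ℝ) * (L k * h (m + k) ^ 3 / 2) ≤ 1 / (2 * b * Real.sqrt b * Real.sqrt kₑ) * ∑ k ∈ Ico kₑ K, Cm * θ ^ k := h1
    _ ≤ 1 / (2 * b * Real.sqrt b * Real.sqrt kₑ) * (Cm * (θ ^ kₑ / (1 - θ))) := mul_le_mul_of_nonneg_left h2 (by positivity)
    _ = Cm * θ ^ kₑ / (2 * (1 - θ) * b * Real.sqrt b * Real.sqrt kₑ) := by field_simp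

/-! ## §3 The END at every range, through the floor -/

/-- **THE LIGHT LOAD AT EVERY RANGE UNDER A GEOMETRIC ENVELOPE, THROUGH THE FLOOR.**  `B` isotone with floor `b > 0` dominating `L ≥ 0` on the ages `< K` (ANY
`K`), `h` a box solution; `L_k ≤ Cm·θ^k` for `k ≥ kₑ` (`kₑ ≥ 2`, `0 ≤ θ < 1`, `Cm ≥ 0`) and
`(√2∕2)(1 + (log kₑ − log 2)∕8) + Cm·θ^{kₑ}∕(2(1−θ)·b√b·√kₑ) ≤ 1`.  Then `Σ_{k<K} k·L_kh(m+k)³∕2 ≤ 1` at every pin. [folklore] -/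
theorem total_load_le_one_of_geometric_envelope_floor (hmono : ∀ u v : ℕ → ℝ, SeqBox γ u → SeqBox γ v → (∀ j, u j ≤ v j) → B u ≤ B v)
    (hL : ∀ k, 0 ≤ L k) (hb : 0 < b) (hlo : ∀ u, SeqBox γ u → b ≤ B u) (hdom : ∀ u, SeqBox γ u → ∑ k ∈ range K, L k * u k ≤ B u)
    (hh : SeqBox γ h) (hf : MemFlow B gIR h) {Cm θ : ℝ} {kₑ : ℕ} (hkₑ : 2 ≤ kₑ) (hCm : 0 ≤ Cm) (hθ0 : 0 ≤ θ) (hθ1 : θ < 1)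
    (henv : ∀ k, kₑ ≤ k → L k ≤ Cm * θ ^ k)
    (hineq : Real.sqrt 2 / 2 * (1 + (Real.log kₑ - Real.log 2) / 8) + Cm * θ ^ kₑ / (2 * (1 - θ) * b * Real.sqrt b * Real.sqrt kₑ) ≤ 1)
    (m : ℕ) : ∑ k ∈ range K, (k : ℝ) * (L k * h (m + k) ^ 3 / 2) ≤ 1 := by
  have hsb := Real.sqrt_pos.2 hb
  have hse : 0 < Real.sqrt kₑ := Real.sqrt_pos.2 (by exact_mod_cast (show 0 < kₑ by omega))
  have h1θ : 0 < 1 - θ := by linarith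
  have htail0 : 0 ≤ Cm * θ ^ kₑ / (2 * (1 - θ) * b * Real.sqrt b * Real.sqrt kₑ) := by positivity
  rcases Nat.lt_or_ge K kₑ with hKk | hkK
  swap
  · exact total_load_le_of_young_and_tail (δ := Cm * θ ^ kₑ / (2 * (1 - θ) * b * Real.sqrt b * Real.sqrt kₑ)) hkK m
      ((young_cluster_le_log hmono hL hb hlo hdom hh hf hkₑ hkK le_rfl m).trans (by linarith))
      (old_tail_load_le_geometric_floor (K := K) hL hb hlo hh hf (by omega) hCm hθ0 hθ1 henv m)
  · rcases Nat.lt_or_ge K 2 with hK2 | hK2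
    · have hK' : range K ⊆ {0} := fun k hk => by rw [mem_singleton]; have := mem_range.mp hk; omega
      calc ∑ k ∈ range K, (k : ℝ) * (L k * h (m + k) ^ 3 / 2) ≤ ∑ k ∈ ({0} : Finset ℕ), (k : ℝ) * (L k * h (m + k) ^ 3 / 2) :=
            sum_le_sum_of_subset_of_nonneg hK' fun k _ _ => by
              have := hL k; have := (hh (m + k)).1; positivity
        _ ≤ 1 := by simp
    · rw [young_cluster_load_eq (fun k => L k * h (m + k) ^ 3 / 2) K]
      exact (young_cluster_le_log hmono hL hb hlo hdom hh hf hK2 le_rfl hKk.le m).trans (by linarith)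

/-- **ROUTE (N), FIRST ORDER — ASYMPTOTIC FREEDOM EXTINGUISHES THE OLD TAIL: THE END AT EVERY RANGE THROUGH THE FLOOR.**  `B` an isotone memory on the box with
floor `b > 0` dominating the profile `L ≥ 0` on the ages `< K` — ANY range `K ≥ 1` —; `L_k ≤ Cm·θ^k` for every `k ≥ kₑ` (`kₑ ≥ 2`, `0 ≤ θ < 1`, `Cm ≥ 0`);
`h` a box solution from any pin; ANY damping `0 < g ≤ 1`; ANY horizon `N ≥ K`; `KL`, `KA`, `RA` as displayed; and
`(√2∕2)(1 + (log kₑ − log 2)∕8) + Cm·θ^{kₑ}∕(2(1−θ)·b√b·√kₑ) ≤ 1`.  THEN `0 ≤ ε m ≤ e m` at every pin for every admissible excess. [folklore] -/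
theorem flow_nonneg_of_geometric_envelope_floor (hmono : ∀ u v : ℕ → ℝ, SeqBox γ u → SeqBox γ v → (∀ j, u j ≤ v j) → B u ≤ B v)
    (hL : ∀ k, 0 ≤ L k) (hb : 0 < b) (hlo : ∀ u, SeqBox γ u → b ≤ B u) (hdom : ∀ u, SeqBox γ u → ∑ k ∈ range K, L k * u k ≤ B u)
    (hh : SeqBox γ h) (hf : MemFlow B gIR h) (hg : ∀ t, 0 < g t ∧ g t ≤ 1) (hK : 1 ≤ K) {N : ℕ} (hKN : K ≤ N)
    {Cm θ : ℝ} {kₑ : ℕ} (hkₑ : 2 ≤ kₑ) (hCm : 0 ≤ Cm) (hθ0 : 0 ≤ θ) (hθ1 : θ < 1) (henv : ∀ k, kₑ ≤ k → L k ≤ Cm * θ ^ k)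
    (hineq : Real.sqrt 2 / 2 * (1 + (Real.log kₑ - Real.log 2) / 8) + Cm * θ ^ kₑ / (2 * (1 - θ) * b * Real.sqrt b * Real.sqrt kₑ) ≤ 1)
    {KL : ℕ → ℕ → ℕ → ℝ}
    (hKL : ∀ k n l, KL k n l = if 0 < k ∧ k < K ∧ l < k then L k * h (n + k) ^ 3 / 2 * ∏ t ∈ Ico (n + 1 + l) (n + k + 1), g t else 0)
    {KA : ℕ → ℕ → ℕ → ℝ} {RA : ℕ → (ℕ → ℝ) → ℕ → ℝ}
    (hRA : ∀ i v m, RA i v m = ∑ l ∈ range K, KA i m l * v (m + 1 + l))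
    (hKA : ∀ i m l, KA i m l = KL i m l + KA (i + 1) m l) (hKAtop : ∀ m l, KA K m l = 0)
    {e ε : ℕ → ℝ} (he0 : ∀ m, 0 ≤ e m) (hea : ∀ m, e (m + 1) ≤ e m)
    (hεt : ∀ m, N < m → ε m = 0) (hεrec : ∀ m, ε m = e m - RA 1 ε m) : ∀ m, 0 ≤ ε m ∧ ε m ≤ e m :=
  flow_nonneg_of_window_loads_le_one hL hh hg hK hKN hKL hRA hKA hKAtop
    (total_load_le_one_of_geometric_envelope_floor hmono hL hb hlo hdom hh hf hkₑ hCm hθ0 hθ1 henv hineq) he0 hea hεt hεrec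

/-! ## §4 Instance `θ ≤ ½` -/

/-- **INSTANCE `θ ≤ ½` THROUGH THE FLOOR**: a geometric envelope `L_k ≤ Cm·θ^k` from the age `32` on with `0 ≤ θ ≤ ½` and `Cm ≤ 10⁹·b√b` gives the END at
EVERY range (the displayed inequality at `kₑ = 32`: `0.9522 + 10⁹·2⁻³²∕√32 ≤ 1`). [folklore] -/
theorem flow_nonneg_of_envelope_floor_half (hmono : ∀ u v : ℕ → ℝ, SeqBox γ u → SeqBox γ v → (∀ j, u j ≤ v j) → B u ≤ B v)
    (hL : ∀ k, 0 ≤ L k) (hb : 0 < b) (hlo : ∀ u, SeqBox γ u → b ≤ B u) (hdom : ∀ u, SeqBox γ u → ∑ k ∈ range K, L k * u k ≤ B u)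
    (hh : SeqBox γ h) (hf : MemFlow B gIR h) (hg : ∀ t, 0 < g t ∧ g t ≤ 1) (hK : 1 ≤ K) {N : ℕ} (hKN : K ≤ N)
    {Cm θ : ℝ} (hCm : 0 ≤ Cm) (hθ0 : 0 ≤ θ) (hθ : θ ≤ 1 / 2) (henv : ∀ k, 32 ≤ k → L k ≤ Cm * θ ^ k) (hC : Cm ≤ 1000000000 * (b * Real.sqrt b))
    {KL : ℕ → ℕ → ℕ → ℝ}
    (hKL : ∀ k n l, KL k n l = if 0 < k ∧ k < K ∧ l < k then L k * h (n + k) ^ 3 / 2 * ∏ t ∈ Ico (n + 1 + l) (n + k + 1), g t else 0)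
    {KA : ℕ → ℕ → ℕ → ℝ} {RA : ℕ → (ℕ → ℝ) → ℕ → ℝ}
    (hRA : ∀ i v m, RA i v m = ∑ l ∈ range K, KA i m l * v (m + 1 + l))
    (hKA : ∀ i m l, KA i m l = KL i m l + KA (i + 1) m l) (hKAtop : ∀ m l, KA K m l = 0)
    {e ε : ℕ → ℝ} (he0 : ∀ m, 0 ≤ e m) (hea : ∀ m, e (m + 1) ≤ e m)
    (hεt : ∀ m, N < m → ε m = 0) (hεrec : ∀ m, ε m = e m - RA 1 ε m) : ∀ m, 0 ≤ ε m ∧ ε m ≤ e m := by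
  have henv' : ∀ k, 32 ≤ k → L k ≤ Cm * (1 / 2 : ℝ) ^ k := fun k hk =>
    (henv k hk).trans (mul_le_mul_of_nonneg_left (pow_le_pow_left₀ hθ0 hθ k) hCm)
  refine flow_nonneg_of_geometric_envelope_floor hmono hL hb hlo hdom hh hf hg hK hKN (kₑ := 32) (by norm_num) hCm (by norm_num)
    (by norm_num) henv' ?_ hKL hRA hKA hKAtop he0 hea hεt hεrec
  have hs := sqrt_two_div_two_le
  have hl2 := Real.log_two_gt_d9
  have hl2' := Real.log_two_lt_d9
  have hl32 : Real.log (32 : ℝ) = (5 : ℕ) * Real.log 2 := by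
    rw [show (32 : ℝ) = 2 ^ 5 by norm_num, Real.log_pow]
  have hyoung : Real.sqrt 2 / 2 * (1 + (Real.log (32 : ℝ) - Real.log 2) / 8) ≤ 0.9522 := by
    rw [hl32]
    push_cast
    have h1 : 1 + (5 * Real.log 2 - Real.log 2) / 8 ≤ 1.34658 := by linarith
    have h0 : 0 ≤ 1 + (5 * Real.log 2 - Real.log 2) / 8 := by linarith
    calc Real.sqrt 2 / 2 * (1 + (5 * Real.log 2 - Real.log 2) / 8) ≤ 0.7071068 * 1.34658 := mul_le_mul hs h1 h0 (by norm_num)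
      _ ≤ 0.9522 := by norm_num
  -- the tail: `Cm·2⁻³²∕(2·½·b√b·√32) ≤ 10⁹·2⁻³²∕√32 ≤ 0.0412`
  have hsb := Real.sqrt_pos.2 hb
  have hbs : 0 < b * Real.sqrt b := mul_pos hb hsb
  have hs32 : (5.656 : ℝ) ≤ Real.sqrt (32 : ℝ) := by
    rw [show (5.656 : ℝ) = Real.sqrt (5.656 ^ 2) by rw [Real.sqrt_sq (by norm_num)]]
    exact Real.sqrt_le_sqrt (by norm_num)
  have hs32pos : 0 < Real.sqrt (32 : ℝ) := by positivity
  have htail : Cm * (1 / 2 : ℝ) ^ (32 : ℕ) / (2 * (1 - 1 / 2) * b * Real.sqrt b * Real.sqrt (32 : ℝ)) ≤ 0.0412 := by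
    rw [div_le_iff₀ (by positivity)]
    have h1 : Cm * (1 / 2 : ℝ) ^ (32 : ℕ) ≤ 1000000000 * (b * Real.sqrt b) * (1 / 2 : ℝ) ^ (32 : ℕ) :=
      mul_le_mul_of_nonneg_right hC (by positivity)
    have h2 : 1000000000 * (b * Real.sqrt b) * (1 / 2 : ℝ) ^ (32 : ℕ) ≤ 0.0412 * (2 * (1 - 1 / 2) * b * Real.sqrt b * 5.656) := by
      have : (1000000000 : ℝ) * (1 / 2 : ℝ) ^ (32 : ℕ) ≤ 0.0412 * (2 * (1 - 1 / 2) * 5.656) := by norm_num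
      have := mul_le_mul_of_nonneg_right this hbs.le
      linarith
    have h3 : 0.0412 * (2 * (1 - 1 / 2) * b * Real.sqrt b * 5.656) ≤ 0.0412 * (2 * (1 - 1 / 2) * b * Real.sqrt b * Real.sqrt (32 : ℝ)) := by
      have := mul_le_mul_of_nonneg_left hs32 hbs.le
      nlinarith
    linarith
  simp only [Nat.cast_ofNat]
  linarith

end Summit.QuantumFields.BalabanUV.Beta.EriceRemainderEnclosureHistoryAutonomyComparisonAgeCompositionFadingEnvelopeFreedom

end
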